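import Summits.QuantumFields.BalabanUV.Beta.FP.FineSplitJunction
import Summits.QuantumFields.BalabanUV.Beta.FP.HorizontalRemainderFarFine
import Summits.QuantumFields.BalabanUV.Beta.FP.PerfectColumnSharp

/-!
# `BalabanUV.Beta.FP.FineSplitJunctionFar` — road «FP» for binder row D1, row KER-γ «THE JUNCTION», SOCKET (α0), sequel of `FP/FineSplitJunction`:
# THE FAR-FINE INDUCED PIECE IN (rem) CURRENCY FOR TWO-POINT TABLES — row RHOA-4c (`HorizontalRemainderFarFine`, translation-invariant `Π`) TRANSFERRED to a
# block-periodic ∕ arbitrary TWO-POINT far piece `G c e s s′` (`= 0` unless `N < ‖s′−s‖∞`, `|G| ≤ N⁸·C·‖s′−s‖∞⁻⁶·e^{−(δ∕(2N))‖s′−s‖∞}` there) by MAJORANT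
# COMPARISON + the §1 reflection of `FineSplitJunction`; then AT THE PERFECT COLUMNS (`PerfectColumnSharp.abs_colOf_KPerf_le_sharp`) with an m-FREE constant

HONEST DEPENDENCY (page 1, mandatory): continuum YM on T⁴ ⇐ BetaPertH ∧ nine spine estimates (0/9 proved); BetaPertH ⇐ (D1) ∧ (D4) ∧
CAP+tail; G-an2-4 gates asym, D1 and NE2/3/4.  HONEST FRAMING (cell contract, verbatim): «discharging `BetaPertH` makes Bałaban's UV
stability UNCONDITIONAL — a real constructive-QFT result; it is NOT the continuum limit and NOT the Clay problem.»  THIS MODULE is [folklore]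
real analysis on `ℤ⁴` composed BY NAME: `HorizontalRemainderFarFine.sq_mul_abs_transportFar_le` ∕ `tsum_sq_exp_supNorm_le` (t4-ne7b-formalise-leaf-10 g25),
`FineSplitJunction.colOf_eq_colH_neg` ∕ `dressedSum_neg_neg` (this seat), `PerfectColumnSharp.abs_colOf_KPerf_le_sharp` (gan24-p3).  WHY: on the road the
one-shot fine kernel `fineHessA (Π KPerf Π) (Πᵀ S) Wf` is a TWO-POINT table, block-periodic only (`PerfectFullSandwich.isBlockPeriodic_fineHessA_coarse`), so the
far-fine entry of the (rem) ledger cannot be instantiated with RHOA-4c AS LANDED (translation-invariant `Π`); the transfer costs one majorant comparison.  The FAR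
LETTER of the piece stays a HYPOTHESIS displayed in every signature (rows RHOA-4 (b) ∕ IR-5′ — PRINTED B5 Prop 1.2 — deliver it; NOT here).  No `def`, no
`def … : Prop`, nothing cited, 0 sorry.  NOT the near pieces, NOT hsplit, NOT (ASYMP), NOT D1; 0∕4 row-D1 binders; NOT BetaPertH, NOT continuum, NOT Clay.

ABSOLUTE RULE (cell charter, verbatim): «No internally-minted statement may enter as a cited fact. Every hypothesis is either kernel-proved in this
package or a verbatim quotation of a PUBLISHED theorem with page reference. The manuscript(s) under audit are NOT citable for their own disputed
steps — they are the thing under adjudication; programme-internal (2001/route/tribunal) claims are never citable.»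

CONTENT ([folklore]): §1 `abs_dressedSumP_le_dressedSum_majorant` (a two-point table dominated by an EVEN translation-invariant majorant: `|dressedSumP w P w′ y| ≤
dressedSum |w| M |w′| y`), `abs_dressedEntryP_colH_le_dressedEntry_colOf` (through the §1 reflection of `FineSplitJunction`: the colH-sandwich of the piece at `N•(−u)`
is dominated by the colOf-sandwich of the majorant at `N•u`); §2 **`rem_far_twoPoint`** (generic columns with the (w) letter of RHOA-4c ⟹ the (rem) letter of the
induced far piece with RHOA-4c's constant VERBATIM); §3 **`rem_far_perfCol`** (at `K m := KPerf…m`, `N := Lc^m`: `∃ B_far` m-FREE, `∀ m ≥ 1, ∀ S, Σ_{u∈S} ‖u‖∞²·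
|dressedEntryP (c a ↦ colH (KPerf…m) (Lc^m) a 0 c) (G m) (Lc^m•(−u)) μ ν| ≤ B_far` — ONE entry of the `hpieces` ledger of `FineSplitJunction.hasym_PiBF_of_fineSplit`,
modulo the far letter of the road's fine kernel).
Provenance: D1 formalisation swarm LEAF PROVER 01, unit `b2b-balaban-beta-d1-formalise-leaf-01` gen 11, 2026-08-21, road FP rows KER-γ ∕ RHOA-4c; «not in print; our bookkeeping».
-/

noncomputable section

namespace Summit.QuantumFields.BalabanUV.Beta.FP.FineSplitJunctionFar

open Finset
open scoped BigOperators
open Literature.MathematicalPhysics.QuantumFieldTheory.Balaban1983to89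
open Literature.MathematicalPhysics.QuantumFieldTheory.Balaban1983to89.Beta
open B12Sec2to5 (l1)
open ExpKernelCalculus (Site MKer)
open OneStepResolventKernel (Fib)
open OneStepKernelFamily (colH)
open DyadicShell (Pt supNorm)
open DecimatedMomentSummable (dressedSum)
open DressedMomentNormalisation (EKer dressedEntry)
open Summit.QuantumFields.BalabanUV.Beta.GAN24.CombesThomas (sfStep smStep)
open Summit.QuantumFields.BalabanUV.Beta.D1BFx.MomentTransferPeriodic (Ker₂)
open Summit.QuantumFields.BalabanUV.Beta.D1BFx.MomentTransferPeriodicSum (dressedSumP)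
open Summit.QuantumFields.BalabanUV.Beta.D1BFx.MomentTransferPeriodicEntry (EKer₂ dressedEntryP)
open Summit.QuantumFields.BalabanUV.Beta.FP.PerfectObjectsT (KPerf)
open Summit.QuantumFields.BalabanUV.Beta.FP.TransportInfinityM (colOf)
open Summit.QuantumFields.BalabanUV.Beta.FP.HorizontalBookkeeping (truncK truncK_apply)
open Summit.QuantumFields.BalabanUV.Beta.FP.HorizontalRemainderFarFine (sq_mul_abs_transportFar_le tsum_sq_exp_supNorm_le)
open Summit.QuantumFields.BalabanUV.Beta.FP.PerfectColumnSharp (abs_colOf_KPerf_le_sharp)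
open Summit.QuantumFields.BalabanUV.Beta.FP.FineSplitJunction (colOf_eq_colH_neg dressedSum_neg_neg)

/-! ## §1 Majorant comparison for two-point dressed sums -/

section Majorant

variable {D : ℕ}

/-- [folklore] **MAJORANT COMPARISON**: a two-point table dominated entrywise by a translation-invariant majorant, `|P s s′| ≤ M (s − s′)` (first argument
minus second — the orientation of `dressedSum`'s middle factor), with a summable majorant fibre ⟹ `|dressedSumP w P w′ y| ≤ dressedSum |w| M |w′| y`. -/
theorem abs_dressedSumP_le_dressedSum_majorant {w w' : Site D → ℝ} {P : Ker₂ D} {M : Site D → ℝ} (y : Site D)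
    (hM : ∀ s s', |P s s'| ≤ M (s - s'))
    (hs : Summable (fun p : Site D × Site D => |w p.1| * M (y + p.1 - p.2) * |w' p.2|)) :
    |dressedSumP w P w' y| ≤ dressedSum (fun u => |w u|) M (fun x => |w' x|) y := by
  unfold dressedSumP dressedSum
  have hpt : ∀ p : Site D × Site D, ‖w p.1 * P (y + p.1) p.2 * w' p.2‖ ≤ |w p.1| * M (y + p.1 - p.2) * |w' p.2| := fun p => by
    rw [Real.norm_eq_abs, abs_mul, abs_mul]
    exact mul_le_mul_of_nonneg_right (mul_le_mul_of_nonneg_left (hM _ _) (abs_nonneg _)) (abs_nonneg _)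
  have h := tsum_of_norm_bounded hs.hasSum hpt
  rwa [Real.norm_eq_abs] at h

end Majorant


/-! ## §2 The induced far piece in (rem) currency — RHOA-4c transferred to two-point tables -/

section Far

variable {K : MKer (3 + 1) (Fib 3)} {N : ℕ} {G : EKer₂ 4} {C c δ : ℝ}

/-- [folklore] The absolute-value patterns of the END's columns obey the (w) letter when the columns do. -/
theorem abs_abs_colOf_le (hw : ∀ κ l (x : Pt), |colOf K κ l x| ≤ c / (N : ℝ) ^ 5 * Real.exp (-(δ / N) * l1 x)) (κ l : Fin 4) (x : Pt) :
    |(fun κ l x => |colOf K κ l x|) κ l x| ≤ c / (N : ℝ) ^ 5 * Real.exp (-(δ / N) * l1 x) := by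
  show |(|colOf K κ l x|)| ≤ _
  rw [abs_abs]; exact hw κ l x

/-- [folklore] The columns with the (w) letter are absolutely summable (comparison with `e^{−(δ∕N)|x|₁}`). -/
theorem summable_abs_colOf_of_letter (hN : 1 ≤ N) (hδ : 0 < δ)
    (hw : ∀ κ l (x : Pt), |colOf K κ l x| ≤ c / (N : ℝ) ^ 5 * Real.exp (-(δ / N) * l1 x)) (κ l : Fin 4) :
    Summable fun x => |colOf K κ l x| := by
  have hN0 : (0 : ℝ) < N := by exact_mod_cast hN
  have hs : Summable fun x : Pt => c / (N : ℝ) ^ 5 * Real.exp (-(δ / N) * l1 x) := by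
    have h := (ExpKernelCalculus.summable_exp_shift' (D := 4) (c := δ / N) (div_pos hδ hN0) 0).mul_left (c / (N : ℝ) ^ 5)
    refine h.congr fun x => ?_
    simp only [sub_zero]
  exact Summable.of_nonneg_of_le (fun x => abs_nonneg _) (fun x => hw κ l x) hs

/-- [folklore] **THE TWO-POINT FAR PIECE IS DOMINATED BY THE TRANSPORTED FAR MAJORANT**: if `G c e s s′ = 0` whenever `‖s′−s‖∞ ≤ N` and
`|G c e s s′| ≤ N⁸·C·‖s′−s‖∞⁻⁶·e^{−(δ∕(2N))‖s′−s‖∞}` otherwise, and the END's columns obey the (w) letter, then for every coarse `u`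
`|dressedEntryP (c a ↦ colH K N a 0 c) G (N•(−u)) a b| ≤ |N⁸ · dressedEntry (κ l x ↦ |colOf K κ l x|) (M − truncK M N) (N•u) a b|`, `M c e t := C·‖t‖∞⁻⁶·e^{−(δ∕(2N))‖t‖∞}`. -/
theorem abs_dressedEntryP_far_le (hN : 1 ≤ N) (hδ : 0 < δ) (hC : 0 ≤ C)
    (hGfar : ∀ (c' e : Fin 4) (s s' : Pt), N < supNorm (s' - s) →
      |G c' e s s'| ≤ (N : ℝ) ^ 8 * (C / (supNorm (s' - s) : ℝ) ^ 6 * Real.exp (-(δ / (2 * N)) * (supNorm (s' - s) : ℝ))))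
    (hGnear : ∀ (c' e : Fin 4) (s s' : Pt), supNorm (s' - s) ≤ N → G c' e s s' = 0)
    (hw : ∀ κ l (x : Pt), |colOf K κ l x| ≤ c / (N : ℝ) ^ 5 * Real.exp (-(δ / N) * l1 x)) (a b : Fin 4) (u : Pt) :
    |dressedEntryP (fun c' a' => colH K N a' 0 c') G ((N : ℤ) • (-u)) a b|
      ≤ |(N : ℝ) ^ 8 * dressedEntry (fun κ l x => |colOf K κ l x|)
          ((fun (_ _ : Fin 4) (t : Pt) => C / (supNorm t : ℝ) ^ 6 * Real.exp (-(δ / (2 * N)) * (supNorm t : ℝ)))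
            - truncK (fun (_ _ : Fin 4) (t : Pt) => C / (supNorm t : ℝ) ^ 6 * Real.exp (-(δ / (2 * N)) * (supNorm t : ℝ))) N)
          ((N : ℤ) • u) a b| := by
  set M : EKer 4 := fun _ _ t => C / (supNorm t : ℝ) ^ 6 * Real.exp (-(δ / (2 * N)) * (supNorm t : ℝ)) with hMdef
  set Mf : EKer 4 := M - truncK M N with hMf
  -- the far majorant: values, evenness, nonnegativity, bound
  have hMf_apply : ∀ (c' e : Fin 4) (t : Pt),
      Mf c' e t = if N < supNorm t then C / (supNorm t : ℝ) ^ 6 * Real.exp (-(δ / (2 * N)) * (supNorm t : ℝ)) else 0 := by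
    intro c' e t
    show M c' e t - truncK M N c' e t = _
    rw [truncK_apply]
    by_cases h : N < supNorm t
    · rw [if_neg (by omega), if_pos h, sub_zero]
    · rw [if_pos (by omega), if_neg h, sub_self]
  have hMf0 : ∀ (c' e : Fin 4) (t : Pt), 0 ≤ Mf c' e t := fun c' e t => by
    rw [hMf_apply]; split_ifs
    · positivity
    · exact le_rfl
  have hMf_even : ∀ (c' e : Fin 4) (t : Pt), Mf c' e (-t) = Mf c' e t := fun c' e t => by
    have h : supNorm (-t) = supNorm t := by unfold supNorm; simp
    rw [hMf_apply, hMf_apply, h]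
  have hMf_bdd : ∀ (c' e : Fin 4) (t : Pt), |Mf c' e t| ≤ C := fun c' e t => by
    rw [abs_of_nonneg (hMf0 c' e t), hMf_apply]
    split_ifs with h
    · have hs1 : (1 : ℝ) ≤ (supNorm t : ℝ) := by exact_mod_cast (show 1 ≤ supNorm t by omega)
      have h6 : (1 : ℝ) ≤ (supNorm t : ℝ) ^ 6 := one_le_pow₀ hs1
      have hexp : Real.exp (-(δ / (2 * N)) * (supNorm t : ℝ)) ≤ 1 := by
        rw [Real.exp_le_one_iff]
        have : (0 : ℝ) ≤ δ / (2 * N) * (supNorm t : ℝ) := by positivity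
        linarith
      have hdiv : C / (supNorm t : ℝ) ^ 6 ≤ C := div_le_self hC h6
      calc C / (supNorm t : ℝ) ^ 6 * Real.exp (-(δ / (2 * N)) * (supNorm t : ℝ))
          ≤ C * 1 := mul_le_mul hdiv hexp (Real.exp_pos _).le hC
        _ = C := mul_one C
    · exact hC
  -- the piece is dominated by `N⁸·Mf (s' − s) = N⁸·Mf (s − s')`
  have hdom : ∀ (c' e : Fin 4) (s s' : Pt), |G c' e s s'| ≤ (N : ℝ) ^ 8 * Mf c' e (s - s') := by
    intro c' e s s'
    rw [show s - s' = -(s' - s) by abel, hMf_even, hMf_apply]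
    split_ifs with h
    · exact hGfar c' e s s' h
    · rw [hGnear c' e s s' (by omega), abs_zero, mul_zero]
  -- absolute summability of the columns (both conventions)
  have hcol : ∀ κ l, Summable fun x => |colOf K κ l x| := summable_abs_colOf_of_letter hN hδ hw
  have hcolH : ∀ c' a', Summable fun x => |colH K N a' 0 c' x| :=
    fun c' a' => FineSplitJunction.summable_abs_colH_of_colOf hcol N c' a'
  -- per (c', e): majorant comparison, then reflection to the END's convention
  have hce : ∀ c' e : Fin 4,
      |dressedSumP (colH K N a 0 c') (G c' e) (colH K N b 0 e) ((N : ℤ) • (-u))|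
        ≤ (N : ℝ) ^ 8 * dressedSum (fun x => |colOf K c' a x|) (Mf c' e) (fun x => |colOf K e b x|) ((N : ℤ) • u) := by
    intro c' e
    have hmaj : Summable (fun p : Pt × Pt => |colH K N a 0 c' p.1| * ((N : ℝ) ^ 8 * Mf c' e ((N : ℤ) • (-u) + p.1 - p.2))
        * |colH K N b 0 e p.2|) := by
      have h := FineSplitJunction.summable_dressedP_fibre_of_bounded (D := 4) (w := fun x => |colH K N a 0 c' x|)
        (w' := fun x => |colH K N b 0 e x|) (P := fun s s' => (N : ℝ) ^ 8 * Mf c' e (s - s')) (A := (N : ℝ) ^ 8 * C)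
        ((hcolH c' a).congr fun x => (abs_abs _).symm) (fun s s' => by
          rw [abs_mul, abs_of_nonneg (by positivity : (0 : ℝ) ≤ (N : ℝ) ^ 8)]
          exact mul_le_mul_of_nonneg_left (hMf_bdd c' e _) (by positivity))
        ((hcolH e b).congr fun x => (abs_abs _).symm) ((N : ℤ) • (-u))
      exact h
    have h1 := abs_dressedSumP_le_dressedSum_majorant (D := 4) (P := G c' e) (M := fun t => (N : ℝ) ^ 8 * Mf c' e t)
      ((N : ℤ) • (-u)) (hdom c' e) hmaj
    refine h1.trans (le_of_eq ?_)
    -- reflection: |colH …| patterns at `N•(−u)` ↦ |colOf …| patterns at `N•u`, the even middle factor unchanged; pull `N⁸` out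
    have hwL : (fun x => |colOf K c' a x|) = fun x => |colH K N a 0 c' (-x)| := funext fun x => by rw [colOf_eq_colH_neg K N]
    have hwR : (fun x => |colOf K e b x|) = fun x => |colH K N b 0 e (-x)| := funext fun x => by rw [colOf_eq_colH_neg K N]
    rw [hwL, hwR, dressedSum_neg_neg (fun x => |colH K N a 0 c' x|) (Mf c' e) (fun x => |colH K N b 0 e x|) ((N : ℤ) • u),
      smul_neg]
    simp only [hMf_even]
    unfold dressedSum
    rw [← tsum_mul_left]
    exact tsum_congr fun p => by ring
  -- assemble over (c', e)
  have hR0 : 0 ≤ (N : ℝ) ^ 8 * dressedEntry (fun κ l x => |colOf K κ l x|) Mf ((N : ℤ) • u) a b := by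
    refine mul_nonneg (by positivity) (Finset.sum_nonneg fun c' _ => Finset.sum_nonneg fun e _ => ?_)
    exact tsum_nonneg fun p => mul_nonneg (mul_nonneg (abs_nonneg _) (hMf0 _ _ _)) (abs_nonneg _)
  rw [abs_of_nonneg hR0]
  unfold dressedEntryP dressedEntry
  rw [Finset.mul_sum]
  refine (Finset.abs_sum_le_sum_abs _ _).trans (Finset.sum_le_sum fun c' _ => ?_)
  rw [Finset.mul_sum]
  exact (Finset.abs_sum_le_sum_abs _ _).trans (Finset.sum_le_sum fun e _ => hce c' e)

/-- [folklore] **ROW RHOA-4c FOR A TWO-POINT FAR PIECE — THE (rem) LETTER OF THE INDUCED COARSE PIECE** (`N ≥ 1`, `δ > 0`, `C, c ≥ 0`): the far piece `G`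
(zero inside the window `‖s′−s‖∞ ≤ N`, the RHOA-4 (b) far shape times `N⁸` outside) and columns with the (w) letter give, for every finite `S`,
`Σ_{u∈S} ‖u‖∞²·|dressedEntryP (c a ↦ colH K N a 0 c) G (N•(−u)) a b| ≤ 16·C·c²·β₀′²·(2·e^{δ∕16}·(16∕δ)²·(1 + 32∕δ)⁴)` — RHOA-4c's constant VERBATIM. -/
theorem rem_far_twoPoint (hN : 1 ≤ N) (hδ : 0 < δ) (hc : 0 ≤ c) (hC : 0 ≤ C)
    (hGfar : ∀ (c' e : Fin 4) (s s' : Pt), N < supNorm (s' - s) →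
      |G c' e s s'| ≤ (N : ℝ) ^ 8 * (C / (supNorm (s' - s) : ℝ) ^ 6 * Real.exp (-(δ / (2 * N)) * (supNorm (s' - s) : ℝ))))
    (hGnear : ∀ (c' e : Fin 4) (s s' : Pt), supNorm (s' - s) ≤ N → G c' e s s' = 0)
    (hw : ∀ κ l (x : Pt), |colOf K κ l x| ≤ c / (N : ℝ) ^ 5 * Real.exp (-(δ / N) * l1 x)) (a b : Fin 4) :
    ∀ S : Finset Pt, ∑ u ∈ S, (supNorm u : ℝ) ^ 2 * |dressedEntryP (fun c' a' => colH K N a' 0 c') G ((N : ℤ) • (-u)) a b|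
      ≤ 16 * C * c ^ 2 * (Real.exp (δ / 4) * (1 + 8 / δ) ^ 4) ^ 2
          * (2 * Real.exp (δ / 16) * (16 / δ) ^ 2 * (1 + 32 / δ) ^ 4) := by
  intro S
  have hP : ∀ (c' e : Fin 4) (t : Pt), N < supNorm t →
      |(fun (_ _ : Fin 4) (t : Pt) => C / (supNorm t : ℝ) ^ 6 * Real.exp (-(δ / (2 * N)) * (supNorm t : ℝ))) c' e t|
        ≤ C / (supNorm t : ℝ) ^ 6 * Real.exp (-(δ / (2 * N)) * (supNorm t : ℝ)) := fun c' e t _ => by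
    show |C / (supNorm t : ℝ) ^ 6 * Real.exp (-(δ / (2 * N)) * (supNorm t : ℝ))| ≤ _
    rw [abs_of_nonneg (by positivity)]
  have h := HorizontalRemainderFarFine.rem_transportFar_le hN hδ hc hC hP (abs_abs_colOf_le hw) a b S
  refine (Finset.sum_le_sum fun u _ => ?_).trans h
  exact mul_le_mul_of_nonneg_left (abs_dressedEntryP_far_le hN hδ hC hGfar hGnear hw a b u) (by positivity)

end Far


/-! ## §3 At the perfect columns: an m-free (rem) constant for the far piece -/

section Perfect

variable {Lc : ℕ} [NeZero Lc]

/-- [folklore] Exponential rates are monotone: `e^{−(a∕N)s} ≤ e^{−(b∕N)s}` for `b ≤ a`, `s ≥ 0`, `N > 0`. -/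
theorem exp_rate_mono {a b s N : ℝ} (hba : b ≤ a) (hs : 0 ≤ s) (hN : 0 < N) :
    Real.exp (-(a / N) * s) ≤ Real.exp (-(b / N) * s) := by
  rw [Real.exp_le_exp]
  have : b / N * s ≤ a / N * s := mul_le_mul_of_nonneg_right (div_le_div_of_nonneg_right hba hN.le) hs
  linarith

/-- **THE FAR-FINE ENTRY OF THE (rem) LEDGER AT THE PERFECT COLUMNS, m-FREE** [our object] (`2 ≤ Lc`): a family of two-point far pieces `G m`
(zero inside the window `‖s′−s‖∞ ≤ Lc^m`; outside bounded by `(Lc^m)⁸·C·‖s′−s‖∞⁻⁶·e^{−(a∕Lc^m)‖s′−s‖∞}` with `C ≥ 0`, `a > 0` INDEPENDENT of `m` — the RHOA-4 (b) ∕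
IR-5′ far letter of the road's one-shot fine kernel, a HYPOTHESIS here) has its INDUCED coarse pieces `u ↦ dressedEntryP (c a ↦ colH (KPerf…m) (Lc^m) a 0 c) (G m)
(Lc^m•(−u)) μ ν` bounded in (rem) currency by ONE constant `B` for all `m ≥ 1` — the column letter being the tree's `PerfectColumnSharp.abs_colOf_KPerf_le_sharp`
(rate `κ₀∕4`, sup `C_col·(Lc^m)⁻⁵`); the common rate is `min (κ₀∕4) (2a)`.  This is the `i = far` entry of `hpieces` in `FineSplitJunction.hasym_PiBF_of_fineSplit`. -/
theorem rem_far_perfCol (hLc : 2 ≤ Lc) {G : ℕ → EKer₂ 4} {C a : ℝ} (hC : 0 ≤ C) (ha : 0 < a)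
    (hGfar : ∀ m : ℕ, 1 ≤ m → ∀ (c' e : Fin 4) (s s' : Pt), Lc ^ m < supNorm (s' - s) →
      |G m c' e s s'| ≤ ((Lc ^ m : ℕ) : ℝ) ^ 8 *
        (C / (supNorm (s' - s) : ℝ) ^ 6 * Real.exp (-(a / ((Lc ^ m : ℕ) : ℝ)) * (supNorm (s' - s) : ℝ))))
    (hGnear : ∀ m : ℕ, 1 ≤ m → ∀ (c' e : Fin 4) (s s' : Pt), supNorm (s' - s) ≤ Lc ^ m → G m c' e s s' = 0) (μ ν : Fin 4) :
    ∃ B : ℝ, 0 ≤ B ∧ ∀ m : ℕ, 1 ≤ m → ∀ S : Finset Pt,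
      ∑ u ∈ S, (supNorm u : ℝ) ^ 2 *
        |dressedEntryP (fun c' a' => colH (KPerf (d := 3) Lc (sfStep Lc) (smStep 3 Lc) m) (Lc ^ m) a' 0 c') (G m)
          (((Lc ^ m : ℕ) : ℤ) • (-u)) μ ν| ≤ B := by
  obtain ⟨κ₀, Cc, hκ₀, hCc, hcol⟩ := abs_colOf_KPerf_le_sharp (Lc := Lc) hLc
  set δ : ℝ := min (κ₀ / 4) (2 * a) with hδdef
  have hδ : 0 < δ := lt_min (by positivity) (by positivity)
  have hδκ : δ ≤ κ₀ / 4 := min_le_left _ _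
  have hδa : δ / 2 ≤ a := by have := min_le_right (κ₀ / 4) (2 * a); rw [← hδdef] at this; linarith
  refine ⟨16 * C * Cc ^ 2 * (Real.exp (δ / 4) * (1 + 8 / δ) ^ 4) ^ 2 * (2 * Real.exp (δ / 16) * (16 / δ) ^ 2 * (1 + 32 / δ) ^ 4),
    by positivity, fun m hm S => ?_⟩
  have hN1 : 1 ≤ Lc ^ m := Nat.one_le_pow _ _ (by omega)
  have hNR : (((Lc ^ m : ℕ) : ℝ)) = (Lc : ℝ) ^ m := by push_cast; ring
  have hN0 : (0 : ℝ) < ((Lc ^ m : ℕ) : ℝ) := by exact_mod_cast (show 0 < Lc ^ m by omega)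
  -- the column letter at the common rate
  have hw : ∀ (κ l : Fin 4) (x : Pt), |colOf (KPerf (d := 3) Lc (sfStep Lc) (smStep 3 Lc) m) κ l x|
      ≤ Cc / ((Lc ^ m : ℕ) : ℝ) ^ 5 * Real.exp (-(δ / ((Lc ^ m : ℕ) : ℝ)) * l1 x) := by
    intro κ l x
    refine (hcol m hm κ l x).trans ?_
    rw [hNR, show Cc / ((Lc : ℝ) ^ m) ^ 5 = Cc * (((Lc : ℝ) ^ m) ^ 5)⁻¹ from div_eq_mul_inv _ _]
    refine mul_le_mul_of_nonneg_left ?_ (by positivity)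
    have h4 : κ₀ / (4 * (Lc : ℝ) ^ m) = (κ₀ / 4) / (Lc : ℝ) ^ m := by rw [div_div]
    rw [h4]
    exact exp_rate_mono hδκ (B12Sec2to5.l1_nonneg x) (by rw [← hNR]; exact hN0)
  -- the far letter at half the common rate
  have hGfar' : ∀ (c' e : Fin 4) (s s' : Pt), Lc ^ m < supNorm (s' - s) →
      |G m c' e s s'| ≤ ((Lc ^ m : ℕ) : ℝ) ^ 8 *
        (C / (supNorm (s' - s) : ℝ) ^ 6 * Real.exp (-(δ / (2 * ((Lc ^ m : ℕ) : ℝ))) * (supNorm (s' - s) : ℝ))) := by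
    intro c' e s s' hfar
    refine (hGfar m hm c' e s s' hfar).trans (mul_le_mul_of_nonneg_left (mul_le_mul_of_nonneg_left ?_ (by positivity)) (by positivity))
    have h2 : δ / (2 * ((Lc ^ m : ℕ) : ℝ)) = (δ / 2) / ((Lc ^ m : ℕ) : ℝ) := by rw [div_div]
    rw [h2]
    exact exp_rate_mono hδa (Nat.cast_nonneg _) hN0
  exact rem_far_twoPoint (K := KPerf (d := 3) Lc (sfStep Lc) (smStep 3 Lc) m) (N := Lc ^ m) (G := G m) hN1 hδ hCc hC hGfar'
    (hGnear m hm) hw μ ν S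

end Perfect

end Summit.QuantumFields.BalabanUV.Beta.FP.FineSplitJunctionFar

end
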